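import Summits.Ventures.PercRepro.ProfileGapMonoThresholdNullityFourTop
import Summits.Ventures.PercRepro.ProfileGapMonoThresholdThreeAll

/-!
# PercRepro — THE TOP THRESHOLD OF THE CO-RANK-`4` FAMILY ON EVERY FINITE MATROID OF NULLITY `≤ 4`
(p5, gen 33; `proofs/P5-GM1.md` §45)

`ThresholdIneq N 4 (ρ(E) − 1)` for every finite matroid `N` with `#E ≤ ρ(E) + 4` and `ρ(E) ≥ 4` — no simplicity,
no coloop-freeness, no looplessness.  Assembly by strong induction on `#E`, the shape of `thresholdIneq_three_all`:
rank `4` is the vacuous `(I_4)` through `thresholdIneq_pred_iff`; a loop is deleted at the same threshold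
(`thresholdIneq_top_of_loop`); a coloop lowers the rank and the threshold together (`thresholdIneq_top_of_coloop`);
a point `z` of a parallel pair `z ∥ z'` is deletion-monotone — THE PARALLEL-PAIR REDUCTION: the subsets of `E` in
which the pair is partial occur twice in `N` and not at all in `N ∖ z`, and carry the ranks of `N ∖ z ／ z'` raised by
one on both sides, so `Φ_t(N) − Φ_t(N ∖ z) = 2·[4·#T'' − Σ_{L''} (ρ''(E''∖X) + 1)] ≥ 0` by the co-rank-`3` family of
`N ∖ z ／ z'` at its top threshold (`delMonoT_of_parallel` with `thresholdIneq_three_all`; the extra `+1` per demanding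
set is paid by `ρ'' ≥ t − 1 ≥ 3`); and a simple coloop-free matroid of rank `≥ 5` has nullity `≤ 2` (the family is
empty: a rank-`3` set with a spanning complement has at most `ν ≤ 2` points), `3`
(`thresholdIneq_four_top_of_nullity_three`) or `4` (`thresholdIneq_four_top_of_nullity_four`).  At rank `5`: THE ROW
`(3, 4)` ON EVERY MATROID WITH AT MOST `9` POINTS; at rank `6` with `≤ 10` points: `(★_4)` at the level `5`.
Nothing open is asserted.

* `thresholdIneq_four_top_of_nullity_le_two`, **`thresholdIneq_four_top_of_nullity_le_four`**,
  **`profileIneqMinusQ_three_four_of_card_le_nine`**, **`profileIneq_three_four_of_card_le_nine`**,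
  `starQ_four_five_of_card_le_ten`.
-/

open scoped Matroid

namespace PercRepro.Cogirth

open Finset ThmH Skew Shadow Profile

variable {α : Type} [DecidableEq α]

section NullityLeTwo

variable {N : Matroid α} [N.Finite]

/-- **At nullity `≤ 2` the top threshold of the co-rank-`4` family is vacuous**: a rank-`3` set whose complement
has rank `ρ(E)` has at least `ρ(E)` points outside it, hence at most `#E − ρ(E) ≤ 2 < 3` points of its own. -/
theorem thresholdIneq_four_top_of_nullity_le_two (hn : (gr N).card ≤ rk N (gr N) + 2) :
    ThresholdIneq N 4 (rk N (gr N) - 1) := by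
  unfold ThresholdIneq thresholdSum
  have hzero : ∀ B ∈ Rq N (4 - 1),
      (if rk N (gr N) - 1 + 1 ≤ rk N (gr N \ B) then rk N (gr N \ B) else 0) = 0 := by
    intro B hB
    rw [if_neg]
    have hBg : B ⊆ gr N := (mem_Rq.1 hB).1
    have hB3 : rk N B = 3 := rk_eq_of_eRk_eq (mem_Rq.1 hB).2
    have hBc : rk N B ≤ B.card := rk_le_card' B
    have hBE : rk N B ≤ rk N (gr N) := rk_mono' hBg
    have h1 := card_sdiff_add_card_eq_card hBg
    have h2 : rk N (gr N \ B) ≤ (gr N \ B).card := rk_le_card' _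
    omega
  rw [sum_congr rfl hzero, sum_const_zero]
  exact Nat.zero_le _

end NullityLeTwo

section All

/-- **THE TOP THRESHOLD OF THE CO-RANK-`4` FAMILY ON EVERY FINITE MATROID OF NULLITY `≤ 4` AND RANK `≥ 4`**:
`#E ≤ ρ(E) + 4` and `4 ≤ ρ(E)` give `Σ_{ρ(B) = 3, E ∖ B spanning} ρ(E) ≤ 4 · #{S : ρ(S) = 4, ρ(E ∖ S) ≥ ρ(E) − 1}` —
loops, coloops and parallel elements allowed (strong induction on `#E`: loop / coloop / parallel-pair deletion, then the
simple coloop-free theorems at nullity `≤ 2`, `3`, `4`). -/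
theorem thresholdIneq_four_top_of_nullity_le_four (N : Matroid α) [N.Finite]
    (hn : (gr N).card ≤ rk N (gr N) + 4) (hR : 4 ≤ rk N (gr N)) :
    ThresholdIneq N 4 (rk N (gr N) - 1) := by
  suffices H : ∀ n, ∀ (N : Matroid α) [N.Finite], (gr N).card = n →
      (gr N).card ≤ rk N (gr N) + 4 → 4 ≤ rk N (gr N) → ThresholdIneq N 4 (rk N (gr N) - 1) from
    H _ N rfl hn hR
  intro n
  induction n using Nat.strong_induction_on with
  | _ n ih =>
  intro N _ hn hnu hR
  -- rank exactly `4`: the threshold `3 = q − 1` is the vacuous `(I_4)`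
  rcases Nat.lt_or_ge (rk N (gr N)) 5 with hR4 | hR5
  · have h4 : rk N (gr N) = 4 := by omega
    have h : ThresholdIneq N 4 4 := thresholdIneq_of_rk_le (by omega)
    have h' : ThresholdIneq N 4 (4 - 1) := (thresholdIneq_pred_iff (by norm_num)).2 h
    rw [h4]
    exact h'
  -- a loop: deleted at the same threshold, the rank unchanged
  by_cases hloop : ∃ ℓ ∈ gr N, rk N {ℓ} = 0
  · obtain ⟨ℓ, hℓ, h0⟩ := hloop
    have hpos : 0 < (gr N).card := card_pos.2 ⟨ℓ, hℓ⟩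
    have hrk : rk (N ＼ ({ℓ} : Set α)) (gr (N ＼ ({ℓ} : Set α))) = rk N (gr N) := by
      rw [gr_delete', rk_delete (Subset.refl _)]
      have h := rk_insert_of_loop hℓ h0 (erase_subset ℓ (gr N))
      rw [insert_erase hℓ] at h
      exact h.symm
    have hcard : (gr (N ＼ ({ℓ} : Set α))).card = (gr N).card - 1 := by
      rw [gr_delete', card_erase_of_mem hℓ]
    have h := ih _ (by omega) (N ＼ ({ℓ} : Set α)) rfl (by omega) (by omega)
    rw [hrk] at h
    exact thresholdIneq_top_of_loop hℓ h0 h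
  push Not at hloop
  have hone : ∀ x ∈ gr N, rk N {x} = 1 := by
    intro x hx
    have hle : rk N {x} ≤ ({x} : Finset α).card := rk_le_card' _
    rw [card_singleton] at hle
    have := hloop x hx
    omega
  -- a coloop: the rank and the threshold drop together
  by_cases hcol : ∃ z ∈ gr N, rk N ((gr N).erase z) + 1 = rk N (gr N)
  · obtain ⟨z, hz, hzc⟩ := hcol
    have hpos : 0 < (gr N).card := card_pos.2 ⟨z, hz⟩
    have hrk := rk_gr_delete_of_coloop hzc
    have hcard : (gr (N ＼ ({z} : Set α))).card = (gr N).card - 1 := by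
      rw [gr_delete', card_erase_of_mem hz]
    exact thresholdIneq_top_of_coloop hz hzc (by norm_num) (by omega)
      (ih _ (by omega) (N ＼ ({z} : Set α)) rfl (by omega) (by omega))
  push Not at hcol
  have hcf : ∀ z ∈ gr N, rk N ((gr N).erase z) = rk N (gr N) := by
    intro z hz
    have h := hcol z hz
    have := rk_le_rk_erase_add_one (M := N) (Subset.refl _) hz
    have := rk_mono' (M := N) (erase_subset z (gr N))
    omega
  -- a parallel pair: the parallel-pair reduction with the co-rank-`3` family of `N ∖ z ／ z'`
  by_cases hpar : ∃ z ∈ gr N, ∃ z' ∈ gr N, z ≠ z' ∧ rk N {z, z'} = 1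
  · obtain ⟨z, hz, z', hz', hzz', h1⟩ := hpar
    have hpos : 0 < (gr N).card := card_pos.2 ⟨z, hz⟩
    have hdel : ThresholdIneq (N ＼ ({z} : Set α) ／ ({z'} : Set α)) (4 - 1) (rk N (gr N) - 1 - 1) :=
      thresholdIneq_three_all _ (by omega)
    have hrk : rk (N ＼ ({z} : Set α)) (gr (N ＼ ({z} : Set α))) = rk N (gr N) := by
      rw [gr_delete', rk_delete (Subset.refl _)]
      exact hcf z hz
    have hcard : (gr (N ＼ ({z} : Set α))).card = (gr N).card - 1 := by
      rw [gr_delete', card_erase_of_mem hz]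
    have h := ih _ (by omega) (N ＼ ({z} : Set α)) rfl (by omega) (by omega)
    rw [hrk] at h
    exact thresholdIneq_of_delMonoT
      (delMonoT_of_parallel hz hz' hzz' (hone z hz) (hone z' hz') h1 (by norm_num) (by omega) hdel) h
  push Not at hpar
  have hpair : ∀ x ∈ gr N, ∀ y ∈ gr N, x ≠ y → rk N {x, y} = 2 := by
    intro x hx y hy hxy
    have hne1 := hpar x hx y hy hxy
    have hle : rk N {x, y} ≤ ({x, y} : Finset α).card := rk_le_card' _
    rw [card_pair hxy] at hle
    have hmono : rk N {x} ≤ rk N {x, y} := rk_mono' (singleton_subset_iff.2 (mem_insert_self _ _))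
    have := hone x hx
    omega
  -- simple, loopless, coloop-free, rank `≥ 5`: the nullity decides
  rcases Nat.lt_or_ge (gr N).card (rk N (gr N) + 3) with hnu2 | hnu3
  · exact thresholdIneq_four_top_of_nullity_le_two (by omega)
  rcases Nat.lt_or_ge (gr N).card (rk N (gr N) + 4) with hnu3' | hnu4
  · exact thresholdIneq_four_top_of_nullity_three hcf (by omega) (by omega)
  · exact thresholdIneq_four_top_of_nullity_four hpair hcf (by omega) hR5

/-- **THE ROW `(3, 4)` OF `Π⁻` ON EVERY RANK-`5` MATROID WITH AT MOST `9` POINTS** (no other hypothesis): the top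
threshold `t = 4` at rank `5` is `(I_4) ⟺ (I_3)`, the row. -/
theorem profileIneqMinusQ_three_four_of_card_le_nine (N : Matroid α) [N.Finite]
    (hR : rk N (gr N) = 5) (hn : (gr N).card ≤ 9) : ProfileIneqMinusQ N 3 4 := by
  have h := thresholdIneq_four_top_of_nullity_le_four N (by omega) (by omega)
  rw [hR] at h
  have h' : ThresholdIneq N 4 (4 - 1) := (thresholdIneq_pred_iff (by norm_num)).2 h
  exact (thresholdIneq_iff_row (by norm_num)).1 h'

/-- **THE ROW `(Π_{3,4})` ON EVERY RANK-`5` MATROID WITH AT MOST `9` POINTS.** -/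
theorem profileIneq_three_four_of_card_le_nine (N : Matroid α) [N.Finite]
    (hR : rk N (gr N) = 5) (hn : (gr N).card ≤ 9) : ProfileIneq N 3 4 :=
  profileIneq_of_minusQ (by norm_num) (profileIneqMinusQ_three_four_of_card_le_nine N hR hn)

/-- **`(★_4)` at the level `5`** for every point `z` of a matroid whose deletion `M ∖ z` has rank `6` and at most
`10` points: the coloop band case of the hard rule's dispatch at co-rank `4`, from the top threshold of `M ∖ z`. -/
theorem starQ_four_five_of_card_le_ten (M : Matroid α) [M.Finite] (z : α)
    (hR : rk (M ＼ ({z} : Set α)) (gr (M ＼ ({z} : Set α))) = 6)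
    (hn : (gr (M ＼ ({z} : Set α))).card ≤ 10) : StarQ M z 4 5 := by
  have h := thresholdIneq_four_top_of_nullity_le_four (M ＼ ({z} : Set α)) (by omega) (by omega)
  rw [hR] at h
  exact (starQ_succ_iff_thresholdIneq (by norm_num)).2 h

end All

end PercRepro.Cogirth
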